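import Summits.QuantumFields.BalabanUV.Beta.D1BFx.KCombineCovLegs

/-!
# `BalabanUV.Beta.D1BFx.KGramCovJets` — road «BF-x» for binder row D1, slot (K), (K) CLOSURE PLAN (R1-L) v0.2 §7 row **(A2-Φ), JET HALF**: at TB4-W's
# jets (`T• = Tjet• N̂ e₁`, `A• = Ajet• N̂`, weight jets `B• = gram•(T•, A•)`) and the gauge jets of THE CONVENTION of `TorusCoframeJets`
# (`Ŵ₀ = D̂ₛN̂`, `Wₛ = Ê_b·N̂`, `Wₜ = Ê_{b′}·N̂`, `Wₛₜ = [b = b′]•Ê_b·N̂` — «every derivative of `D_U` at one bond is the same shift table»), the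
# «GRAM-COV» functional `bΦ` of `KCombineCov.identity_array_currency_cov_What0` IS THE bi-LAPLACIAN FUNCTIONAL:
# `hessT (Φ₀⁻¹; Φₛ, Φₜ, Φₛₜ) = hessT (Gjet₀⁻¹; Gjet₁ b, Gjet₁ b′, Gjet₁₁ b b′) = hessT ((Cgh (m+1) a)^; (L̂²)ₛᶠ, (L̂²)ₜᶠ, (L̂²)ₛₜᶠ)` under the WARD-L letters
# — `SLICE-TRANSFER-DEFECT.md` §4's `W_UᵀB_UW_U = 2N̂ᵀL_U²N̂` read jet by jet; the Φ-slot's site words are route T's ghost words `(L̂²)•` of `KGhostTerm`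
# (TB5-2c-A, second functional), whose ARRAY dictionary is `TorusJetArrays` — no new word family (owner d1-p2-g9 ρ-g9-18; this lineage's INTENT, journal l.28639)

HONEST FRAMING (cell contract, verbatim): «discharging `BetaPertH` makes Bałaban's UV stability UNCONDITIONAL — a real constructive-QFT
result; it is NOT the continuum limit and NOT the Clay problem.»  HONEST DEPENDENCY (verbatim): «continuum YM on T⁴ ⇐ BetaPertH ∧ nine
spine estimates (0/9 proved); BetaPertH ⇐ (D1) ∧ (D4) ∧ CAP+tail; G-an2-4 gates asym, D1 and NE2/3/4.»  THIS MODULE DISCHARGES NOTHING of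
D1 ∕ BetaPertH: [folklore] finite matrix algebra over this lineage's `TorusCoframeJets` (`Djet`, `Ljet`, `Ljet₁₁_eq_jets`, `Mjet•`, `Tjet•`, `Gjet•`,
`Ajet•`, `hessT_Ajet_road`), `TorusWeightJetsCombFree` (`Lsq•`, `Gjet•_eq`), gan24-leaf-03's `GramWeightJetsMixed.hessT_gram_split_jets` (GENERIC gauge jets),
the owner's `KGhostTerm` (`Tjet_mul_basis`, `submatrix_mul_submatrix_equiv`, `hessT_compress`), `TorusHodgeWeight.Dhat_transpose_mul_Dhat`,
and `KCombineCovLegs` (p252994: `Tjet₀_mul_What0`, `det_Tjet₀_mul_What0_ne_zero`, `det_Ajet₀_Nhat_ne_zero`, `gram₁∕gramMix_add_eq_of_wardL`, `hessT_submatrix_fst`) BY NAME.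
No `def`, no `def … : Prop`, nothing cited, 0 sorry.  DISPLAYED: the WARD-L letters `hEₛ hEₜ hEₛₜ` for the typed `K•` (Q1) and the gauge-jet letters `hW•` (THE CONVENTION's
`D_U N̂` jets); exact-ℚ model evidence for the letters' reading: `HOME/…/leaf-03/g11/a2phi/gram_vs_gjet.py` (Φₛ = −2•Gjet₁, Φₛₜ = 2•Gjet₁₁, functional equal; the
opposite W-sign fails).  NOT summit progress; NOT BetaPertH, NOT continuum, NOT Clay.

ABSOLUTE RULE (cell, verbatim): «No internally-minted statement may enter as a cited fact. Every hypothesis is either kernel-proved in this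
package or a verbatim quotation of a PUBLISHED theorem with page reference. The manuscript(s) under audit are NOT citable for their own
disputed steps — they are the thing under adjudication; programme-internal (2001/route/tribunal) claims are never citable.»

CONTENT (all [folklore]; `s = (m+1)·p`, `N̂ = Nhat r (m+1) p`, `D̂ = Dhat 4 s`, `L̂ = Lhat s`, `Ê_b = Djet s b`, `Xᶠ := X.submatrix Prod.fst Prod.fst`).
* §1 site algebra of THE CONVENTION: **`Mjet₁_mul_Dhat_add`** (`M̂ₛ·D̂ + M̂₀·Ê_b = (L̂²)ₛ`, only `D̂ᵀD̂ = L̂`), **`MjetMix_mul_sum`**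
  (`M̂ₛₜ·D̂ + M̂ₛ·Ê_{b′} + M̂ₜ·Ê_b + [b=b′]•M̂₀·Ê_b = (L̂²)ₛₜ`, by `Ljet₁₁_eq_jets`).
* §2 road currency (sorted, `e₁`): `Tjet_mul_Djet_basis` (`(N̂ᵀM).submatrix id e₁ · (Ê.submatrix e₁ id · N̂) = N̂ᵀ(M·Ê)N̂`), **`TW_jet₁_eq_Gjet₁`**
  (`TₛŴ₀ + T₀Wₛ = Gjet₁ s b N̂`), **`TW_jetMix_eq_Gjet₁₁`** (`TₛₜŴ₀ + TₛWₜ + TₜWₛ + T₀Wₛₜ = Gjet₁₁ s b b′ N̂`).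
* §3 **`hessT_gramCov_B_eq_Gjet`** — the Gram tower of the WEIGHT jets alone: `hessT (gram₀ Ŵ₀ B₀)⁻¹ (gram₁ Ŵ₀ Wₛ B₀ Bₛ) (gram₁ Ŵ₀ Wₜ B₀ Bₜ) (gramMix …)
  = hessT (Gjet₀ N̂)⁻¹ (Gjet₁ b N̂) (Gjet₁ b′ N̂) (Gjet₁₁ b b′ N̂)` (`hessT_gram_split_jets` + §2 + `hessT_Ajet_road`: `2·h − h = h`);
  **`hessT_gramCov_What0_eq_Gjet`** — the §3′ `hbΦ` functional with `Y• = K• + B•` under the WARD-L letters (order 0 free by `Khat_mul_What0`);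
  **`hessT_gramCov_What0_eq_Cgh_Lsq`** — `= hessT ((Cgh (m+1) a)^; ((L̂²)ₛ)ᶠ, ((L̂²)ₜ)ᶠ, ((L̂²)ₛₜ)ᶠ)`: the «GRAM-COV» slot of `hId` in fibred site currency with
  route T's ghost words.
Unit `b2b-balaban-beta-d1-formalise-leaf-03` (gen 11); road owner `b2b-balaban-beta-d1-p2`.
-/

noncomputable section

namespace Summit.QuantumFields.BalabanUV.Beta.D1BFx.KGramCovJets

open Matrix
open scoped BigOperators
open Literature.MathematicalPhysics.QuantumFieldTheory.Balaban1983to89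
open Literature.MathematicalPhysics.QuantumFieldTheory.Balaban1983to89.Beta
open AffineAveraging (box toSite)
open Summit.QuantumFields.BalabanUV.Beta.D1BFx.FibredPeriodisation (periodiseF)
open Summit.QuantumFields.BalabanUV.Beta.D1BFx.SortedEmbedding (e₁)
open Summit.QuantumFields.BalabanUV.Beta.D1BFx.PeriodicArrays (toF)
open Summit.QuantumFields.BalabanUV.Beta.D1BFx.MixedVarPackedHess (hessT)
open Summit.QuantumFields.BalabanUV.Beta.D1BFx.GramWeightJets (gram₀ gram₁)
open Summit.QuantumFields.BalabanUV.Beta.D1BFx.GramWeightJetsMixed (gramMix hessT_gram_split_jets)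
open Summit.QuantumFields.BalabanUV.Beta.D1BFx.TorusCombKKT (I J CombRows tauT Khat Qhat)
open Summit.QuantumFields.BalabanUV.Beta.D1BFx.TorusGaugeBasis (What0 Khat_mul_What0)
open Summit.QuantumFields.BalabanUV.Beta.D1BFx.TorusGaugeBasisMatrix (Nhat)
open Summit.QuantumFields.BalabanUV.Beta.D1BFx.TorusGaugeBasisKernel (Nhat_range Nhat_injective What0_eq_DhatS_mul_Nhat)
open Summit.QuantumFields.BalabanUV.Beta.D1BFx.PeriodisedProjector (Lhat)
open Summit.QuantumFields.BalabanUV.Beta.D1BFx.TorusHodgeWeight (Dhat DhatS Dhat_transpose_mul_Dhat)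
open Summit.QuantumFields.BalabanUV.Beta.D1BFx.TorusCoframeJets (Djet Ljet Ljet₁₁ Ljet₁₁_eq_jets Mjet₀ Mjet₁ Mjet₁₁ Tjet₀ Tjet₁ Tjet₁₁ Gjet₀ Gjet₁ Gjet₁₁
  Ajet₀ Ajet₁ Ajet₁₁ hessT_Ajet_road)
open Summit.QuantumFields.BalabanUV.Beta.D1BFx.TorusWeightJetsCombFree (Lsq₀ Lsq₁ Lsq₁₁ Gjet₀_eq Gjet₁_eq Gjet₁₁_eq)
open Summit.QuantumFields.BalabanUV.Beta.D1BFx.KGhostLeg (Cgh)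
open Summit.QuantumFields.BalabanUV.Beta.D1BFx.KGhostLegJunction (Chat_Nhat_eq_submatrix_periodiseF_Cgh)
open Summit.QuantumFields.BalabanUV.Beta.D1BFx.TorusWeightJetsCombFree (Chat)
open Summit.QuantumFields.BalabanUV.Beta.D1BFx.KGhostTerm (hessT_compress Tjet_mul_basis submatrix_mul_submatrix_equiv)
open Summit.QuantumFields.BalabanUV.Beta.D1BFx.KCombineCovLegs (Tjet₀_mul_What0 det_Tjet₀_mul_What0_ne_zero det_Ajet₀_Nhat_ne_zero
  gram₁_add_eq_of_wardL gramMix_add_eq_of_wardL hessT_submatrix_fst)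

/-! ## §1 Site algebra of THE CONVENTION: the co-frame jets against the gauge jets re-assemble the bi-Laplacian jets -/

section Site

variable (s : ℕ) [NeZero s] (b b' : Site 4 s × Fin 4)

/-- [folklore] **`M̂ₛ·D̂ + M̂₀·Ê_b = (L̂²)ₛ`**: `(Ljet·D̂ᵀ − L̂·Êᵀ)·D̂ + L̂·D̂ᵀ·Ê = Ljet·L̂ + L̂·(D̂ᵀÊ − ÊᵀD̂) = Ljet·L̂ + L̂·Ljet` (only `D̂ᵀD̂ = L̂`). -/
theorem Mjet₁_mul_Dhat_add : Mjet₁ s b * Dhat 4 s + Mjet₀ s * Djet s b = Lsq₁ s b := by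
  rw [Mjet₁, Mjet₀, Lsq₁, Matrix.sub_mul, Matrix.mul_assoc (Ljet s b), Dhat_transpose_mul_Dhat, Matrix.mul_assoc (Lhat s), Matrix.mul_assoc (Lhat s)]
  rw [show Lhat s * Ljet s b = Lhat s * ((Dhat 4 s)ᵀ * Djet s b) - Lhat s * ((Djet s b)ᵀ * Dhat 4 s) by rw [Ljet, Matrix.mul_sub]]
  abel

/-- [folklore] **`M̂ₛₜ·D̂ + M̂ₛ·Ê_{b′} + M̂ₜ·Ê_b + [b = b′]•M̂₀·Ê_b = (L̂²)ₛₜ`** (`Ljet₁₁_eq_jets`: `Ljet₁₁ = [b=b′]•(ÊᵀD̂ + D̂ᵀÊ) − (ÊᵀÊ′ + Ê′ᵀÊ)`; `D̂ᵀD̂ = L̂`). -/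
theorem MjetMix_mul_sum :
    Mjet₁₁ s b b' * Dhat 4 s + Mjet₁ s b * Djet s b' + Mjet₁ s b' * Djet s b + (if b = b' then Mjet₀ s * Djet s b else 0)
      = Lsq₁₁ s b b' := by
  have hL : (Dhat 4 s)ᵀ * Dhat 4 s = Lhat s := Dhat_transpose_mul_Dhat s
  -- expand `L̂·Ljet₁₁` on the right by `Ljet₁₁_eq_jets`; `Ljet₁₁·L̂` stays atomic on both sides
  have key : Lhat s * Ljet₁₁ s b b'
      = (if b = b' then Lhat s * ((Djet s b)ᵀ * Dhat 4 s) + Lhat s * ((Dhat 4 s)ᵀ * Djet s b) else 0)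
        - (Lhat s * ((Djet s b)ᵀ * Djet s b') + Lhat s * ((Djet s b')ᵀ * Djet s b)) := by
    rw [Ljet₁₁_eq_jets, Matrix.mul_sub, Matrix.mul_add (Lhat s) ((Djet s b)ᵀ * Djet s b')]
    split_ifs
    · rw [Matrix.mul_add]
    · rw [Matrix.mul_zero]
  by_cases h : b = b'
  · subst h
    have e1 : (if b = b then Mjet₀ s * Djet s b else 0) = Lhat s * ((Dhat 4 s)ᵀ * Djet s b) := by
      rw [if_pos rfl, Mjet₀, Matrix.mul_assoc]
    have e2 : Mjet₁₁ s b b * Dhat 4 s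
        = Ljet₁₁ s b b * Lhat s - (Ljet s b * ((Djet s b)ᵀ * Dhat 4 s) + Ljet s b * ((Djet s b)ᵀ * Dhat 4 s))
          + Lhat s * ((Djet s b)ᵀ * Dhat 4 s) := by
      rw [Mjet₁₁, if_pos rfl, Matrix.add_mul, Matrix.sub_mul, Matrix.add_mul, Matrix.mul_assoc, hL, Matrix.mul_assoc, Matrix.mul_assoc]
    rw [e1, e2, Lsq₁₁, key, if_pos rfl, Mjet₁]
    simp only [Matrix.sub_mul, Matrix.mul_sub, Matrix.mul_assoc, Ljet]
    abel
  · have e1 : (if b = b' then Mjet₀ s * Djet s b else 0) = 0 := if_neg h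
    have e2 : Mjet₁₁ s b b' * Dhat 4 s
        = Ljet₁₁ s b b' * Lhat s - (Ljet s b * ((Djet s b')ᵀ * Dhat 4 s) + Ljet s b' * ((Djet s b)ᵀ * Dhat 4 s)) := by
      rw [Mjet₁₁, if_neg h, add_zero, Matrix.sub_mul, Matrix.add_mul, Matrix.mul_assoc, hL, Matrix.mul_assoc, Matrix.mul_assoc]
    rw [e1, e2, Lsq₁₁, key, if_neg h, Mjet₁, Mjet₁, add_zero, zero_sub]
    simp only [Matrix.sub_mul, Matrix.mul_sub, Matrix.mul_assoc, Ljet]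
    abel

end Site

/-! ## §2 Road currency: the `(T·W)`-jets of THE CONVENTION are the bi-Laplacian Gram jets -/

section Road

variable (m : ℕ) {a : ℝ} (p : ℕ) [NeZero p] {r : Fin 4 → ℕ}

/-- [folklore] `(N̂ᵀM).submatrix id e₁ · (Ê.submatrix e₁ id · N′) = N̂ᵀ(M·Ê)N′` (re-indexing the summation over bonds by the `Equiv` `e₁`). -/
theorem Tjet_mul_Djet_basis {ρ ρ' : Type*} (N : Matrix (Site 4 ((m + 1) * p)) ρ ℝ) (N' : Matrix (Site 4 ((m + 1) * p)) ρ' ℝ)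
    (M : Matrix (Site 4 ((m + 1) * p)) (Site 4 ((m + 1) * p) × Fin 4) ℝ) (E : Matrix (Site 4 ((m + 1) * p) × Fin 4) (Site 4 ((m + 1) * p)) ℝ) :
    (Nᵀ * M).submatrix id (e₁ (m + 1) p) * (E.submatrix (e₁ (m + 1) p) id * N') = Nᵀ * (M * E) * N' := by
  rw [← Matrix.mul_assoc, submatrix_mul_submatrix_equiv]
  simp only [Matrix.mul_assoc]

/-- [folklore] **`(T·W)ₛ = Gjet₁`**: at `T₀ = Tjet₀ N̂ e₁`, `Tₛ = Tjet₁ b N̂ e₁`, `Ŵ₀ = D̂ₛN̂`, `Wₛ = Ê_b·N̂`: `TₛŴ₀ + T₀Wₛ = N̂ᵀ(M̂ₛD̂ + M̂₀Ê_b)N̂ = Gjet₁ s b N̂`. -/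
theorem TW_jet₁_eq_Gjet₁ (hr : r ∈ box 4 (m + 1)) (b : Site 4 ((m + 1) * p) × Fin 4) :
    Tjet₁ ((m + 1) * p) b (Nhat r (m + 1) p) (e₁ (m + 1) p) * What0 r (m + 1) p
        + Tjet₀ ((m + 1) * p) (Nhat r (m + 1) p) (e₁ (m + 1) p) * ((Djet ((m + 1) * p) b).submatrix (e₁ (m + 1) p) id * Nhat r (m + 1) p)
      = Gjet₁ ((m + 1) * p) b (Nhat r (m + 1) p) := by
  rw [What0_eq_DhatS_mul_Nhat r m p hr, Tjet₁, Tjet_mul_basis, Tjet₀, Tjet_mul_Djet_basis, Gjet₁_eq, ← Mjet₁_mul_Dhat_add]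
  simp only [Matrix.mul_add, Matrix.add_mul]

/-- [folklore] **`(T·W)ₛₜ = Gjet₁₁`**: `TₛₜŴ₀ + TₛWₜ + TₜWₛ + T₀Wₛₜ = N̂ᵀ(M̂ₛₜD̂ + M̂ₛÊ_{b′} + M̂ₜÊ_b + [b=b′]•M̂₀Ê_b)N̂ = Gjet₁₁ s b b′ N̂`, the mixed gauge jet being
`Wₛₜ = [b = b′]•Ê_b·N̂` (THE CONVENTION: cross-bond mixed jets of `D_U` vanish, the same-bond one is the shift table again). -/
theorem TW_jetMix_eq_Gjet₁₁ (hr : r ∈ box 4 (m + 1)) (b b' : Site 4 ((m + 1) * p) × Fin 4) :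
    Tjet₁₁ ((m + 1) * p) b b' (Nhat r (m + 1) p) (e₁ (m + 1) p) * What0 r (m + 1) p
        + Tjet₁ ((m + 1) * p) b (Nhat r (m + 1) p) (e₁ (m + 1) p) * ((Djet ((m + 1) * p) b').submatrix (e₁ (m + 1) p) id * Nhat r (m + 1) p)
        + Tjet₁ ((m + 1) * p) b' (Nhat r (m + 1) p) (e₁ (m + 1) p) * ((Djet ((m + 1) * p) b).submatrix (e₁ (m + 1) p) id * Nhat r (m + 1) p)
        + Tjet₀ ((m + 1) * p) (Nhat r (m + 1) p) (e₁ (m + 1) p)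
          * (if b = b' then (Djet ((m + 1) * p) b).submatrix (e₁ (m + 1) p) id * Nhat r (m + 1) p else 0)
      = Gjet₁₁ ((m + 1) * p) b b' (Nhat r (m + 1) p) := by
  rw [What0_eq_DhatS_mul_Nhat r m p hr, Tjet₁₁, Tjet_mul_basis, Tjet₁, Tjet_mul_Djet_basis, Tjet₁, Tjet_mul_Djet_basis, Tjet₀, Gjet₁₁_eq,
    ← MjetMix_mul_sum]
  by_cases h : b = b'
  · rw [if_pos h, if_pos h, Tjet_mul_Djet_basis]
    simp only [Matrix.mul_add, Matrix.add_mul]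
  · rw [if_neg h, if_neg h, Matrix.mul_zero, add_zero, add_zero]
    simp only [Matrix.mul_add, Matrix.add_mul]

/-! ## §3 The Gram tower at TB4-W's jets is the bi-Laplacian functional -/

/-- [folklore] **THE COVARIANT GRAM TOWER OF THE WEIGHT JETS IS THE bi-LAPLACIAN FUNCTIONAL.**  At `T• = Tjet• N̂ e₁`, `A• = Ajet• N̂`, `B• = gram•(T•, A•)`,
`Ŵ₀ = What0`, `Wₛ = Ê_b·N̂`, `Wₜ = Ê_{b′}·N̂`, `Wₛₜ = [b=b′]•Ê_b·N̂` (letters `hW•`):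
`hessT ((gram₀ Ŵ₀ B₀)⁻¹; gram₁ Ŵ₀ Wₛ B₀ Bₛ, gram₁ Ŵ₀ Wₜ B₀ Bₜ, gramMix Ŵ• B•) = hessT (Gjet₀⁻¹; Gjet₁ b, Gjet₁ b′, Gjet₁₁ b b′)` — by the GENERIC Gram split
`= 2·hessT((T₀Ŵ₀)⁻¹; (TW)•) + hessT(A₀⁻¹; A•)` (`hessT_gram_split_jets`), §2 (`(TW)• = Gjet•`, `T₀Ŵ₀ = Gjet₀`) and `hessT_Ajet_road` (`= −hessT(Gjet₀⁻¹; Gjet•)`). -/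
theorem hessT_gramCov_B_eq_Gjet (ha : 0 < a) (hr : r ∈ box 4 (m + 1)) (b b' : Site 4 ((m + 1) * p) × Fin 4)
    {Wₛ Wₜ Wₛₜ : Matrix (I 3 (m + 1) p) (CombRows (toSite r) (m + 1) p) ℝ}
    (hWₛ : Wₛ = (Djet ((m + 1) * p) b).submatrix (e₁ (m + 1) p) id * Nhat r (m + 1) p)
    (hWₜ : Wₜ = (Djet ((m + 1) * p) b').submatrix (e₁ (m + 1) p) id * Nhat r (m + 1) p)
    (hWₛₜ : Wₛₜ = if b = b' then (Djet ((m + 1) * p) b).submatrix (e₁ (m + 1) p) id * Nhat r (m + 1) p else 0) :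
    hessT (gram₀ (What0 r (m + 1) p)
              (gram₀ (Tjet₀ ((m + 1) * p) (Nhat r (m + 1) p) (e₁ (m + 1) p)) (Ajet₀ ((m + 1) * p) (Nhat r (m + 1) p))))⁻¹
        (gram₁ (What0 r (m + 1) p) Wₛ
          (gram₀ (Tjet₀ ((m + 1) * p) (Nhat r (m + 1) p) (e₁ (m + 1) p)) (Ajet₀ ((m + 1) * p) (Nhat r (m + 1) p)))
          (gram₁ (Tjet₀ ((m + 1) * p) (Nhat r (m + 1) p) (e₁ (m + 1) p)) (Tjet₁ ((m + 1) * p) b (Nhat r (m + 1) p) (e₁ (m + 1) p))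
            (Ajet₀ ((m + 1) * p) (Nhat r (m + 1) p)) (Ajet₁ ((m + 1) * p) b (Nhat r (m + 1) p))))
        (gram₁ (What0 r (m + 1) p) Wₜ
          (gram₀ (Tjet₀ ((m + 1) * p) (Nhat r (m + 1) p) (e₁ (m + 1) p)) (Ajet₀ ((m + 1) * p) (Nhat r (m + 1) p)))
          (gram₁ (Tjet₀ ((m + 1) * p) (Nhat r (m + 1) p) (e₁ (m + 1) p)) (Tjet₁ ((m + 1) * p) b' (Nhat r (m + 1) p) (e₁ (m + 1) p))
            (Ajet₀ ((m + 1) * p) (Nhat r (m + 1) p)) (Ajet₁ ((m + 1) * p) b' (Nhat r (m + 1) p))))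
        (gramMix (What0 r (m + 1) p) Wₛ Wₜ Wₛₜ
          (gram₀ (Tjet₀ ((m + 1) * p) (Nhat r (m + 1) p) (e₁ (m + 1) p)) (Ajet₀ ((m + 1) * p) (Nhat r (m + 1) p)))
          (gram₁ (Tjet₀ ((m + 1) * p) (Nhat r (m + 1) p) (e₁ (m + 1) p)) (Tjet₁ ((m + 1) * p) b (Nhat r (m + 1) p) (e₁ (m + 1) p))
            (Ajet₀ ((m + 1) * p) (Nhat r (m + 1) p)) (Ajet₁ ((m + 1) * p) b (Nhat r (m + 1) p)))
          (gram₁ (Tjet₀ ((m + 1) * p) (Nhat r (m + 1) p) (e₁ (m + 1) p)) (Tjet₁ ((m + 1) * p) b' (Nhat r (m + 1) p) (e₁ (m + 1) p))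
            (Ajet₀ ((m + 1) * p) (Nhat r (m + 1) p)) (Ajet₁ ((m + 1) * p) b' (Nhat r (m + 1) p)))
          (gramMix (Tjet₀ ((m + 1) * p) (Nhat r (m + 1) p) (e₁ (m + 1) p)) (Tjet₁ ((m + 1) * p) b (Nhat r (m + 1) p) (e₁ (m + 1) p))
            (Tjet₁ ((m + 1) * p) b' (Nhat r (m + 1) p) (e₁ (m + 1) p)) (Tjet₁₁ ((m + 1) * p) b b' (Nhat r (m + 1) p) (e₁ (m + 1) p))
            (Ajet₀ ((m + 1) * p) (Nhat r (m + 1) p)) (Ajet₁ ((m + 1) * p) b (Nhat r (m + 1) p)) (Ajet₁ ((m + 1) * p) b' (Nhat r (m + 1) p))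
            (Ajet₁₁ ((m + 1) * p) b b' (Nhat r (m + 1) p))))
      = hessT (Gjet₀ ((m + 1) * p) (Nhat r (m + 1) p))⁻¹ (Gjet₁ ((m + 1) * p) b (Nhat r (m + 1) p)) (Gjet₁ ((m + 1) * p) b' (Nhat r (m + 1) p))
          (Gjet₁₁ ((m + 1) * p) b b' (Nhat r (m + 1) p)) := by
  have hT := det_Tjet₀_mul_What0_ne_zero m p ha hr
  have hA := det_Ajet₀_Nhat_ne_zero m p ha hr
  have h := hessT_gram_split_jets (Tjet₀ ((m + 1) * p) (Nhat r (m + 1) p) (e₁ (m + 1) p)) (Tjet₁ ((m + 1) * p) b (Nhat r (m + 1) p) (e₁ (m + 1) p))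
    (Tjet₁ ((m + 1) * p) b' (Nhat r (m + 1) p) (e₁ (m + 1) p)) 0 0 (Tjet₁₁ ((m + 1) * p) b b' (Nhat r (m + 1) p) (e₁ (m + 1) p))
    (Ajet₀ ((m + 1) * p) (Nhat r (m + 1) p)) (Ajet₁ ((m + 1) * p) b (Nhat r (m + 1) p)) (Ajet₁ ((m + 1) * p) b' (Nhat r (m + 1) p)) 0 0
    (Ajet₁₁ ((m + 1) * p) b b' (Nhat r (m + 1) p)) (What0 r (m + 1) p) Wₛ Wₜ 0 0 Wₛₜ hT hA
  rw [h, hessT_Ajet_road m p ha (Nhat_range r m p hr) (Nhat_injective r (m + 1) p hr) b b', Tjet₀_mul_What0 m p hr, hWₛ, hWₜ, hWₛₜ,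
    TW_jet₁_eq_Gjet₁ m p hr b, TW_jet₁_eq_Gjet₁ m p hr b']
  have hmix := TW_jetMix_eq_Gjet₁₁ m p hr b b'
  rw [show Tjet₁₁ ((m + 1) * p) b b' (Nhat r (m + 1) p) (e₁ (m + 1) p) * What0 r (m + 1) p
        + Tjet₁ ((m + 1) * p) b (Nhat r (m + 1) p) (e₁ (m + 1) p) * ((Djet ((m + 1) * p) b').submatrix (e₁ (m + 1) p) id * Nhat r (m + 1) p)
        + Tjet₁ ((m + 1) * p) b' (Nhat r (m + 1) p) (e₁ (m + 1) p) * ((Djet ((m + 1) * p) b).submatrix (e₁ (m + 1) p) id * Nhat r (m + 1) p)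
        + Tjet₀ ((m + 1) * p) (Nhat r (m + 1) p) (e₁ (m + 1) p)
          * (if b = b' then (Djet ((m + 1) * p) b).submatrix (e₁ (m + 1) p) id * Nhat r (m + 1) p else 0)
      = Gjet₁₁ ((m + 1) * p) b b' (Nhat r (m + 1) p) from hmix, Gjet₀]
  ring

/-- [folklore] **THE «GRAM-COV» FUNCTIONAL `bΦ` OF `KCombineCov.identity_array_currency_cov_What0` AT TB4-W's JETS IS THE bi-LAPLACIAN FUNCTIONAL.**
With the total weight jets `Y• = K• + B•` (`B• = gram•(Tjet•, Ajet•)`), the gauge jets of THE CONVENTION (letters `hW•`) and the WARD-L letters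
`hEₛ hEₜ hEₛₜ` (order 0 is `Khat_mul_What0`), the `K`-parts drop (`KCombineCovLegs` §3) and §3's split applies:
`hessT ((gram₀ Ŵ₀ Y₀)⁻¹; gram₁ Ŵ₀ Wₛ Y₀ Yₛ, gram₁ Ŵ₀ Wₜ Y₀ Yₜ, gramMix Ŵ• Y•) = hessT (Gjet₀⁻¹; Gjet₁ b, Gjet₁ b′, Gjet₁₁ b b′)`. -/
theorem hessT_gramCov_What0_eq_Gjet (ha : 0 < a) (hr : r ∈ box 4 (m + 1)) (b b' : Site 4 ((m + 1) * p) × Fin 4)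
    (Kₛ Kₜ Kₛₜ : Matrix (I 3 (m + 1) p) (I 3 (m + 1) p) ℝ)
    {Wₛ Wₜ Wₛₜ : Matrix (I 3 (m + 1) p) (CombRows (toSite r) (m + 1) p) ℝ}
    (hWₛ : Wₛ = (Djet ((m + 1) * p) b).submatrix (e₁ (m + 1) p) id * Nhat r (m + 1) p)
    (hWₜ : Wₜ = (Djet ((m + 1) * p) b').submatrix (e₁ (m + 1) p) id * Nhat r (m + 1) p)
    (hWₛₜ : Wₛₜ = if b = b' then (Djet ((m + 1) * p) b).submatrix (e₁ (m + 1) p) id * Nhat r (m + 1) p else 0)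
    (hEₛ : Kₛ * What0 r (m + 1) p + Khat (d := 3) (m + 1) p * Wₛ = 0) (hEₜ : Kₜ * What0 r (m + 1) p + Khat (d := 3) (m + 1) p * Wₜ = 0)
    (hEₛₜ : Kₛₜ * What0 r (m + 1) p + Kₛ * Wₜ + Kₜ * Wₛ + Khat (d := 3) (m + 1) p * Wₛₜ = 0)
    {B₀ Bₛ Bₜ Bₛₜ : Matrix (I 3 (m + 1) p) (I 3 (m + 1) p) ℝ}
    (hB₀ : B₀ = gram₀ (Tjet₀ ((m + 1) * p) (Nhat r (m + 1) p) (e₁ (m + 1) p)) (Ajet₀ ((m + 1) * p) (Nhat r (m + 1) p)))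
    (hBₛ : Bₛ = gram₁ (Tjet₀ ((m + 1) * p) (Nhat r (m + 1) p) (e₁ (m + 1) p)) (Tjet₁ ((m + 1) * p) b (Nhat r (m + 1) p) (e₁ (m + 1) p))
      (Ajet₀ ((m + 1) * p) (Nhat r (m + 1) p)) (Ajet₁ ((m + 1) * p) b (Nhat r (m + 1) p)))
    (hBₜ : Bₜ = gram₁ (Tjet₀ ((m + 1) * p) (Nhat r (m + 1) p) (e₁ (m + 1) p)) (Tjet₁ ((m + 1) * p) b' (Nhat r (m + 1) p) (e₁ (m + 1) p))
      (Ajet₀ ((m + 1) * p) (Nhat r (m + 1) p)) (Ajet₁ ((m + 1) * p) b' (Nhat r (m + 1) p)))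
    (hBₛₜ : Bₛₜ = gramMix (Tjet₀ ((m + 1) * p) (Nhat r (m + 1) p) (e₁ (m + 1) p)) (Tjet₁ ((m + 1) * p) b (Nhat r (m + 1) p) (e₁ (m + 1) p))
      (Tjet₁ ((m + 1) * p) b' (Nhat r (m + 1) p) (e₁ (m + 1) p)) (Tjet₁₁ ((m + 1) * p) b b' (Nhat r (m + 1) p) (e₁ (m + 1) p))
      (Ajet₀ ((m + 1) * p) (Nhat r (m + 1) p)) (Ajet₁ ((m + 1) * p) b (Nhat r (m + 1) p)) (Ajet₁ ((m + 1) * p) b' (Nhat r (m + 1) p))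
      (Ajet₁₁ ((m + 1) * p) b b' (Nhat r (m + 1) p))) :
    hessT (gram₀ (What0 r (m + 1) p) (Khat (d := 3) (m + 1) p + B₀))⁻¹
        (gram₁ (What0 r (m + 1) p) Wₛ (Khat (d := 3) (m + 1) p + B₀) (Kₛ + Bₛ))
        (gram₁ (What0 r (m + 1) p) Wₜ (Khat (d := 3) (m + 1) p + B₀) (Kₜ + Bₜ))
        (gramMix (What0 r (m + 1) p) Wₛ Wₜ Wₛₜ (Khat (d := 3) (m + 1) p + B₀) (Kₛ + Bₛ) (Kₜ + Bₜ) (Kₛₜ + Bₛₜ))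
      = hessT (Gjet₀ ((m + 1) * p) (Nhat r (m + 1) p))⁻¹ (Gjet₁ ((m + 1) * p) b (Nhat r (m + 1) p)) (Gjet₁ ((m + 1) * p) b' (Nhat r (m + 1) p))
          (Gjet₁₁ ((m + 1) * p) b b' (Nhat r (m + 1) p)) := by
  have hE₀ : Khat (d := 3) (m + 1) p * What0 r (m + 1) p = 0 := Khat_mul_What0 r (m + 1) p hr
  have h0 : gram₀ (What0 r (m + 1) p) (Khat (d := 3) (m + 1) p + B₀) = gram₀ (What0 r (m + 1) p) B₀ := by
    rw [gram₀, gram₀, Matrix.mul_add, Matrix.add_mul, Matrix.mul_assoc _ (Khat _ _), hE₀, Matrix.mul_zero, zero_add]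
  rw [h0, gram₁_add_eq_of_wardL _ _ _ _ _ _ hE₀ hEₛ, gram₁_add_eq_of_wardL _ _ _ _ _ _ hE₀ hEₜ,
    gramMix_add_eq_of_wardL _ _ _ _ _ _ _ _ _ _ _ _ hE₀ hEₛ hEₜ hEₛₜ, hB₀, hBₛ, hBₜ, hBₛₜ]
  exact hessT_gramCov_B_eq_Gjet m p ha hr b b' hWₛ hWₜ hWₛₜ

/-- [folklore] **… IN FIBRED SITE CURRENCY WITH ROUTE T's GHOST WORDS**: the same functional equals
`hessT ((Cgh (m+1) a)^; ((L̂²)ₛ)ᶠ, ((L̂²)ₜ)ᶠ, ((L̂²)ₛₜ)ᶠ)`, `(L̂²)ₛ = Lsq₁ s b`, `(L̂²)ₛₜ = Lsq₁₁ s b b′` (`Gjet• = N̂ᵀ(L̂²)•N̂`, `KGhostTerm.hessT_compress`,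
`Ĉ = N̂Gjet₀⁻¹N̂ᵀ = (Cgh)^` re-indexed) — the «GRAM-COV» slot of `KCombineCov` §4's `hId` needs NO word family beyond `TorusJetArrays`' dictionary for `Ljet`∕`Ljet₂`∕`Ljet₁₁`. -/
theorem hessT_Gjet_eq_Cgh_Lsq (ha : 0 < a) (hr : r ∈ box 4 (m + 1)) (b b' : Site 4 ((m + 1) * p) × Fin 4) :
    hessT (Gjet₀ ((m + 1) * p) (Nhat r (m + 1) p))⁻¹ (Gjet₁ ((m + 1) * p) b (Nhat r (m + 1) p)) (Gjet₁ ((m + 1) * p) b' (Nhat r (m + 1) p))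
        (Gjet₁₁ ((m + 1) * p) b b' (Nhat r (m + 1) p))
      = hessT (Matrix.of (periodiseF ((m + 1) * p) (toF (Cgh (m + 1) a))))
          ((Lsq₁ ((m + 1) * p) b).submatrix Prod.fst Prod.fst) ((Lsq₁ ((m + 1) * p) b').submatrix Prod.fst Prod.fst)
          ((Lsq₁₁ ((m + 1) * p) b b').submatrix Prod.fst Prod.fst) := by
  rw [Gjet₁_eq, Gjet₁_eq, Gjet₁₁_eq, hessT_compress]
  have hC : Nhat r (m + 1) p * (Gjet₀ ((m + 1) * p) (Nhat r (m + 1) p))⁻¹ * (Nhat r (m + 1) p)ᵀ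
      = (Matrix.of (periodiseF ((m + 1) * p) (toF (Cgh (m + 1) a)))).submatrix (fun x => (x, ())) (fun y => (y, ())) := by
    rw [← Chat_Nhat_eq_submatrix_periodiseF_Cgh m p ha hr, Chat]
  rw [hC, hessT_submatrix_fst]

end Road

end Summit.QuantumFields.BalabanUV.Beta.D1BFx.KGramCovJets

end
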